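import Literature.AlgebraicGeometry.HodgeTheory.HypersurfaceResidueFormHolomorphic
import Literature.Analysis.Complex.InjectiveHolomorphic
import HarnessLib

/-!
# The residue form of a projective hypersurface does not vanish

Family `hodge`, layer `Literature/AlgebraicGeometry/HodgeTheory`. Step S5 of the programme proving
the named fact `Voisin2003_hypersurface_residueForm` (file `HypersurfaceResidueForms`): with
`P = X_{i₀}^{d-m-2}`, the residue form `residueForm ψ F P = ψ^* Res_Y(PΩ/F)` of
`HypersurfaceResidueFormDef` is non-zero at every point of `M_{i₀} = ψ⁻¹(U_{i₀})`
(`residueForm_ne_zero`, PROVED), when `ψ` is a topological embedding with holomorphic affine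
coordinates and `dim_ℂ E = m`. By the local formula, at `x ∈ M_{i₀}` the form is
`det(N, z, dZ̃_{i₀}(x) ·)` (`P(z) = z_{i₀}^{d-m-2} = 1`), which is non-zero on a basis of `E` as soon
as the rows `N, z, dZ̃(x)e₁, …, dZ̃(x)e_m` are linearly independent (`linearIndependent_coneRows`
of `HypersurfaceConeResidue`: `dF(z)` separates `N` from the tangent data, and it remains to see
that `(v, c) ↦ dZ̃(x)v + c z` is injective). The `i₀`-th coordinate of `Z̃_{i₀}` is constantly `1`,
so `dZ̃_{i₀}(x) = J ∘ DΦ(c)` with `J` the insertion of a `0` at `i₀` and `Φ` the affine coordinates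
read in the chart at `x` (`liftDeriv_eq_finInsertCLM_comp`); hence `c = 0`, and the heart is the
**injectivity of `DΦ(c)`** (`injective_liftDeriv`): `Φ` is injective (as `ψ` is) and holomorphic
near `c`; on the hypersurface `{f = 0}` (`f` the local equation in the chart `U_{i₀}`) the
coordinate projection forgetting a coordinate `k` with `∂_k f ≠ 0` is injective near `Φ(c)`
(strict differentiability, `eq_of_finRemoveCLM_eq_of_hasStrictFDerivAt`), so `π_k ∘ Φ` is an
injective holomorphic map between spaces of the same dimension `m`, whose differential is
therefore injective by the **Clements–Osgood theorem** (Fritzsche–Grauert I.8.5,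
`Literature.Analysis.Complex.SCV.injective_fderiv_of_injOn`, PROVED in the tree). In print: the
residue of `Ω/F` is a nowhere-vanishing section of `K_Y` over `U_{i₀}` (locally
`± dx_K/(∂f/∂x_j)`, Voisin II §6.1.3; Thm. 6.10 / Cor. 6.12 at `p = 1`), transported along the
holomorphic homeomorphism `ψ`.

## References

* C. Voisin, *Hodge Theory and Complex Algebraic Geometry II* (2003), §6.1.3, Thm. 6.10, Cor. 6.12.
* K. Fritzsche, H. Grauert, *From Holomorphic Functions to Complex Manifolds* (2002), Ch. I §8,
  Thm. 8.5.
-/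

noncomputable section

open scoped Manifold ContDiff Topology LinearAlgebra.Projectivization
open Set Filter Projectivization

namespace Literature.AlgebraicGeometry.HodgeTheory

open Literature.NumberTheory.Transcendental Literature.Geometry.Kaehler

/-! ### Inserting and removing a coordinate -/

section Fin

variable {m : ℕ}

/-- The linear insertion of a `0` in position `i₀`: `J u = (u₀, …, 0, …, u_m)`
(the differential of `u ↦ (u₀, …, 1, …, u_m)`). [folklore] -/
def finInsertCLM (i₀ : Fin (m + 2)) : (Fin (m + 1) → ℂ) →L[ℂ] (Fin (m + 2) → ℂ) :=
  ContinuousLinearMap.pi (Fin.insertNth i₀ 0 fun k ↦ ContinuousLinearMap.proj k)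

/-- `finInsertCLM i₀ u = Fin.insertNth i₀ 0 u`. [folklore] -/
@[simp]
theorem finInsertCLM_apply (i₀ : Fin (m + 2)) (u : Fin (m + 1) → ℂ) :
    finInsertCLM i₀ u = Fin.insertNth i₀ 0 u := by
  ext j
  refine Fin.succAboveCases i₀ ?_ (fun k ↦ ?_) j <;> simp [finInsertCLM]

/-- `(u₀, …, 1, …, u_m) = e_{i₀} + J u`. [folklore] -/
theorem insertNth_one_eq_single_add (i₀ : Fin (m + 2)) (u : Fin (m + 1) → ℂ) :
    (Fin.insertNth i₀ (1 : ℂ) u : Fin (m + 2) → ℂ) = Pi.single i₀ 1 + finInsertCLM i₀ u := by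
  ext j
  refine Fin.succAboveCases i₀ ?_ (fun k ↦ ?_) j
  · simp
  · simp [Fin.succAbove_ne]

/-- The insertion `J` is injective. [folklore] -/
theorem finInsertCLM_injective (i₀ : Fin (m + 2)) : Function.Injective (finInsertCLM (m := m) i₀) := by
  intro u v h
  ext k
  have := congrFun h (i₀.succAbove k)
  simpa using this

/-- `J e_k = e_{i₀.succAbove k}`. [folklore] -/
theorem finInsertCLM_single (i₀ : Fin (m + 2)) (k : Fin (m + 1)) :
    finInsertCLM i₀ (Pi.single k (1 : ℂ)) = Pi.single (i₀.succAbove k) 1 := by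
  ext j
  rw [finInsertCLM_apply]
  refine Fin.succAboveCases i₀ ?_ (fun l ↦ ?_) j
  · simp
  · simp only [Fin.insertNth_apply_succAbove, Pi.single_apply, Fin.succAbove_right_inj]

/-- The coordinate projection forgetting the `k`-th coordinate: `π_k u = (u_l)_{l ≠ k}`.
[folklore] -/
def finRemoveCLM (k : Fin (m + 1)) : (Fin (m + 1) → ℂ) →L[ℂ] (Fin m → ℂ) :=
  ContinuousLinearMap.pi fun l ↦ ContinuousLinearMap.proj (k.succAbove l)

/-- `finRemoveCLM k u l = u (k.succAbove l)`. [folklore] -/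
@[simp]
theorem finRemoveCLM_apply (k : Fin (m + 1)) (u : Fin (m + 1) → ℂ) (l : Fin m) :
    finRemoveCLM k u l = u (k.succAbove l) := rfl

/-- A vector killed by `π_k` is a multiple of `e_k`. [folklore] -/
theorem eq_single_of_finRemoveCLM_eq_zero {k : Fin (m + 1)} {w : Fin (m + 1) → ℂ}
    (h : finRemoveCLM k w = 0) : w = Pi.single k (w k) := by
  ext j
  refine Fin.succAboveCases k ?_ (fun l ↦ ?_) j
  · simp
  · have := congrFun h l
    simp only [finRemoveCLM_apply, Pi.zero_apply] at this
    simp [this, Fin.succAbove_ne]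

/-- **Local injectivity of a coordinate projection on a hypersurface.** If `f` has a strict
derivative `f'` at `u₀` with `f' e_k ≠ 0`, then near `u₀` two zeros of `f` with the same
coordinates off `k` are equal: with `u - u' = t e_k`,
`|t| ‖f' e_k‖ = ‖f u - f u' - f'(u - u')‖ ≤ ½ ‖f' e_k‖ |t|` forces `t = 0`. (The injectivity
half of the implicit function theorem, from the strict-derivative estimate alone.) [folklore] -/
theorem eq_of_finRemoveCLM_eq_of_hasStrictFDerivAt {f : (Fin (m + 1) → ℂ) → ℂ}
    {f' : (Fin (m + 1) → ℂ) →L[ℂ] ℂ} {u₀ : Fin (m + 1) → ℂ} (hf : HasStrictFDerivAt f f' u₀)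
    {k : Fin (m + 1)} (hk : f' (Pi.single k 1) ≠ 0) :
    ∃ U ∈ 𝓝 u₀, ∀ u ∈ U, ∀ u' ∈ U, f u = 0 → f u' = 0 →
      finRemoveCLM k u = finRemoveCLM k u' → u = u' := by
  set a := f' (Pi.single k 1) with ha
  have hapos : 0 < ‖a‖ / 2 := by positivity
  have h := hf.isLittleO.def hapos
  obtain ⟨U, hU, hUU⟩ : ∃ U ∈ 𝓝 u₀, U ×ˢ U ⊆ {p : (Fin (m + 1) → ℂ) × (Fin (m + 1) → ℂ) |
      ‖f p.1 - f p.2 - f' (p.1 - p.2)‖ ≤ ‖a‖ / 2 * ‖p.1 - p.2‖} := by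
    rw [nhds_prod_eq] at h
    obtain ⟨U₁, hU₁, U₂, hU₂, hsub⟩ := mem_prod_iff.mp h
    exact ⟨U₁ ∩ U₂, inter_mem hU₁ hU₂, fun p hp ↦ hsub ⟨hp.1.1, hp.2.2⟩⟩
  refine ⟨U, hU, fun u hu u' hu' hfu hfu' hπ ↦ ?_⟩
  have hest := hUU (mk_mem_prod hu hu')
  simp only [mem_setOf_eq, hfu, hfu', sub_zero, zero_sub, norm_neg] at hest
  set t := u k - u' k with ht
  have hdiff : u - u' = t • Pi.single k 1 := by
    have h0 : finRemoveCLM k (u - u') = 0 := by rw [map_sub, hπ, sub_self]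
    have := eq_single_of_finRemoveCLM_eq_zero h0
    rw [this]; ext j; simp [Pi.single_apply, ht]
  rw [hdiff, map_smul, norm_smul, norm_smul] at hest
  have hnorm : ‖(Pi.single k 1 : Fin (m + 1) → ℂ)‖ = 1 := by simp [Pi.norm_single]
  rw [hnorm, mul_one, ← ha] at hest
  have ht0 : t = 0 := by
    by_contra hne
    have htpos : 0 < ‖t‖ := norm_pos_iff.mpr hne
    have : ‖a‖ ≤ ‖a‖ / 2 := by nlinarith
    have hapos' : 0 < ‖a‖ := norm_pos_iff.mpr hk
    linarith
  have : u - u' = 0 := by rw [hdiff, ht0, zero_smul]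
  exact sub_eq_zero.mp this

/-- `Z̃_{i₀} = e_{i₀} + J ∘ u_{i₀}` (the lift is the affine coordinates with a `1` inserted).
[folklore] -/
theorem projLift_eq_single_add {M : Type*} (ψ : M → ℙ ℂ (Fin (m + 2) → ℂ)) (i₀ : Fin (m + 2)) (x : M) :
    projLift ψ i₀ x = Pi.single i₀ 1 + finInsertCLM i₀ (affineCoord ψ i₀ x) :=
  insertNth_one_eq_single_add i₀ _

end Fin

/-! ### The lift differential: structure and injectivity -/

section Main

variable {m : ℕ} {E : Type*} [NormedAddCommGroup E] [NormedSpace ℂ E] [FiniteDimensional ℂ E]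
  {M : Type*} [TopologicalSpace M] [ChartedSpace E M] [IsManifold 𝓘(ℂ, E) ω M]
  (ψ : M → ℙ ℂ (Fin (m + 2) → ℂ)) {F : MvPolynomial (Fin (m + 2)) ℂ} {d : ℕ}

/-- An admissible normal index OFF the chart index: if `F(z) = 0`, `z_{i₀} ≠ 0` and some
`∂_jF(z) ≠ 0`, then some `∂_jF(z) ≠ 0` with `j ≠ i₀` (Euler's identity
`Σ_j z_j ∂_jF(z) = d F(z) = 0`). [folklore] -/
theorem exists_succAbove_pderiv_ne_zero (hF : F.IsHomogeneous d) {z : Fin (m + 2) → ℂ}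
    (hz : MvPolynomial.eval z F = 0) (hjac : ∃ j, MvPolynomial.eval z (MvPolynomial.pderiv j F) ≠ 0)
    {i₀ : Fin (m + 2)} (hzi : z i₀ ≠ 0) :
    ∃ k : Fin (m + 1), MvPolynomial.eval z (MvPolynomial.pderiv (i₀.succAbove k) F) ≠ 0 := by
  by_contra h
  push Not at h
  obtain ⟨j, hj⟩ := hjac
  have heuler := polyGrad_apply_self hF z
  rw [hz, mul_zero, polyGrad_apply, Fin.sum_univ_succAbove _ i₀] at heuler
  simp only [h, zero_mul, Finset.sum_const_zero, add_zero] at heuler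
  rcases Fin.eq_self_or_eq_succAbove i₀ j with rfl | ⟨k, rfl⟩
  · exact hj ((mul_eq_zero.mp heuler).resolve_right hzi)
  · exact hj (h k)

omit [FiniteDimensional ℂ E] in
/-- The lift read in the chart at `x₀` is `ℂ`-differentiable over the chart domain `M_i`
(the `DifferentiableOn` core of `analyticAt_projLift_comp_symm`). [folklore] -/
theorem differentiableOn_projLift_comp_symm (hψ : Continuous ψ) (hhol : HasHolomorphicCoords E ψ)
    (i : Fin (m + 2)) (x₀ : M) :
    DifferentiableOn ℂ (projLift ψ i ∘ (extChartAt 𝓘(ℂ, E) x₀).symm)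
      ((extChartAt 𝓘(ℂ, E) x₀).target ∩ (extChartAt 𝓘(ℂ, E) x₀).symm ⁻¹' liftDomain ψ i) := by
  intro y' hy'
  have h1 : MDifferentiableAt 𝓘(ℂ, E) 𝓘(ℂ, Fin (m + 2) → ℂ) (projLift ψ i)
      ((extChartAt 𝓘(ℂ, E) x₀).symm y') :=
    (mdifferentiableOn_projLift ψ hhol i _ hy'.2).mdifferentiableAt
      ((isOpen_liftDomain ψ hψ i).mem_nhds hy'.2)
  have h2 : MDifferentiableWithinAt 𝓘(ℂ, E) 𝓘(ℂ, E) (extChartAt 𝓘(ℂ, E) x₀).symm (range 𝓘(ℂ, E)) y' :=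
    mdifferentiableWithinAt_extChartAt_symm hy'.1
  have h3 := h1.comp_mdifferentiableWithinAt y' h2
  rw [ModelWithCorners.Boundaryless.range_eq_univ, mdifferentiableWithinAt_univ,
    mdifferentiableAt_iff_differentiableAt] at h3
  exact h3.differentiableWithinAt

omit [FiniteDimensional ℂ E] [IsManifold 𝓘(ℂ, E) ω M] in
/-- The chart domain over `M_i` is open. [folklore] -/
theorem isOpen_target_inter_preimage_liftDomain (hψ : Continuous ψ) (i : Fin (m + 2)) (x₀ : M) :
    IsOpen ((extChartAt 𝓘(ℂ, E) x₀).target ∩ (extChartAt 𝓘(ℂ, E) x₀).symm ⁻¹' liftDomain ψ i) :=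
  (continuousOn_extChartAt_symm x₀).isOpen_inter_preimage (isOpen_extChartAt_target x₀)
    (isOpen_liftDomain ψ hψ i)

omit [FiniteDimensional ℂ E] in
/-- **The lift differential is the insertion of the differential of the affine coordinates**:
`dZ̃_{i₀}(x) = J ∘ DΦ(c)`, `Φ = u_{i₀} ∘ chart_x⁻¹`, `c = chart_x(x)`; and `Φ` is differentiable at
`c`. [folklore] -/
theorem liftDeriv_eq_finInsertCLM_comp (hψ : Continuous ψ) (hhol : HasHolomorphicCoords E ψ)
    {i₀ : Fin (m + 2)} {x : M} (hx : x ∈ liftDomain ψ i₀) :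
    liftDeriv ψ i₀ x = (finInsertCLM i₀).comp
      (fderiv ℂ (affineCoord ψ i₀ ∘ (extChartAt 𝓘(ℂ, E) x).symm) (extChartAt 𝓘(ℂ, E) x x)) ∧
    DifferentiableAt ℂ (affineCoord ψ i₀ ∘ (extChartAt 𝓘(ℂ, E) x).symm) (extChartAt 𝓘(ℂ, E) x x) := by
  set c := extChartAt 𝓘(ℂ, E) x x
  set Φ := affineCoord ψ i₀ ∘ (extChartAt 𝓘(ℂ, E) x).symm
  have hmd : MDifferentiableAt 𝓘(ℂ, E) 𝓘(ℂ, Fin (m + 2) → ℂ) (projLift ψ i₀) x :=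
    (mdifferentiableOn_projLift ψ hhol i₀ x hx).mdifferentiableAt
      ((isOpen_liftDomain ψ hψ i₀).mem_nhds hx)
  have hL := mvfderiv_eq_fderiv_comp_symm hmd
  rw [← liftDeriv_eq_mvfderiv] at hL
  have hfun : projLift ψ i₀ ∘ (extChartAt 𝓘(ℂ, E) x).symm =
      fun y ↦ Pi.single i₀ 1 + finInsertCLM i₀ (Φ y) := by
    funext y; exact projLift_eq_single_add ψ i₀ _
  have hcmem : (extChartAt 𝓘(ℂ, E) x).symm c ∈ liftDomain ψ i₀ := by
    show (extChartAt 𝓘(ℂ, E) x).symm (extChartAt 𝓘(ℂ, E) x x) ∈ liftDomain ψ i₀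
    rw [extChartAt_to_inv]; exact hx
  have hZd : DifferentiableAt ℂ (projLift ψ i₀ ∘ (extChartAt 𝓘(ℂ, E) x).symm) c :=
    (differentiableOn_projLift_comp_symm ψ hψ hhol i₀ x).differentiableAt
      ((isOpen_target_inter_preimage_liftDomain ψ hψ i₀ x).mem_nhds ⟨mem_extChartAt_target x, hcmem⟩)
  have hΦd : DifferentiableAt ℂ Φ c := by
    have hcomp : ∀ y k, Φ y k = (projLift ψ i₀ ∘ (extChartAt 𝓘(ℂ, E) x).symm) y (i₀.succAbove k) :=
      fun y k ↦ by simp only [Φ, Function.comp_apply, projLift, Fin.insertNth_apply_succAbove]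
    have : Φ = fun y ↦ fun k ↦ (projLift ψ i₀ ∘ (extChartAt 𝓘(ℂ, E) x).symm) y (i₀.succAbove k) := by
      funext y; funext k; exact hcomp y k
    rw [this]
    refine differentiableAt_pi.mpr fun k ↦ ?_
    exact (differentiableAt_apply (𝕜 := ℂ) (i₀.succAbove k)
      ((projLift ψ i₀ ∘ (extChartAt 𝓘(ℂ, E) x).symm) c)).comp c hZd
  refine ⟨?_, hΦd⟩
  rw [hL, hfun]
  have h2 : HasFDerivAt (fun y ↦ Pi.single i₀ (1 : ℂ) + finInsertCLM i₀ (Φ y))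
      ((finInsertCLM i₀).comp (fderiv ℂ Φ c)) c :=
    (((finInsertCLM i₀).hasFDerivAt).comp c hΦd.hasFDerivAt).const_add _
  exact h2.fderiv

/-- **The lift differential is injective** (Clements–Osgood). With `dZ̃_{i₀}(x) = J ∘ DΦ(c)` it
suffices that `DΦ(c)` be injective. `Φ` is injective on the chart over `M_{i₀}` (as `ψ`, the chart
inverse and the standard chart are) and holomorphic there; `f(Φ y) = 0` for the local equation
`f(u) = F(e_{i₀} + J u)` of the hypersurface, and `f' e_k = ∂_{i₀.succAbove k}F(z) ≠ 0` for some
`k` (`exists_succAbove_pderiv_ne_zero`), so the projection `π_k` is injective on `{f = 0}` near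
`Φ(c)` (`eq_of_finRemoveCLM_eq_of_hasStrictFDerivAt`); thus `π_k ∘ Φ : E → ℂ^m` is injective and
holomorphic on an open neighbourhood of `c`, `dim E = m`, and its differential `π_k ∘ DΦ(c)` is
injective by `Literature.Analysis.Complex.SCV.injective_fderiv_of_injOn` (Fritzsche–Grauert
I.8.5). [cite: FritzscheGrauert2002, Ch. I §8 Thm. 8.5] -/
theorem injective_liftDeriv (hF : F.IsHomogeneous d) (hψ : Topology.IsEmbedding ψ)
    (hrange : Set.range ψ ⊆ projZeroLocus {F})
    (hjac : ∀ z : Fin (m + 2) → ℂ, z ≠ 0 → MvPolynomial.eval z F = 0 →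
      ∃ j, MvPolynomial.eval z (MvPolynomial.pderiv j F) ≠ 0)
    (hhol : HasHolomorphicCoords E ψ) (hdim : Module.finrank ℂ E = m)
    {i₀ : Fin (m + 2)} {x : M} (hx : x ∈ liftDomain ψ i₀) :
    Function.Injective (liftDeriv (E := E) ψ i₀ x) := by
  have hψc : Continuous ψ := hψ.continuous
  set z := projLift ψ i₀ x with hzdef
  have hz0 : MvPolynomial.eval z F = 0 := eval_projLift_eq_zero ψ hF hrange hx
  have hzi : z i₀ = 1 := projLift_apply_self ψ i₀ x
  obtain ⟨k, hk⟩ := exists_succAbove_pderiv_ne_zero hF hz0 (hjac z (projLift_ne_zero ψ i₀ x) hz0)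
    (by rw [hzi]; exact one_ne_zero)
  set c := extChartAt 𝓘(ℂ, E) x x with hcdef
  set Φ := affineCoord ψ i₀ ∘ (extChartAt 𝓘(ℂ, E) x).symm with hΦdef
  obtain ⟨hL, hΦd⟩ := liftDeriv_eq_finInsertCLM_comp ψ hψc hhol hx
  suffices h : Function.Injective
      (fderiv ℂ (affineCoord ψ i₀ ∘ (extChartAt 𝓘(ℂ, E) x).symm) (extChartAt 𝓘(ℂ, E) x x)) by
    rw [hL]; exact (finInsertCLM_injective i₀).comp h
  -- the local equation `f` of the hypersurface in the affine chart `i₀`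
  set f : (Fin (m + 1) → ℂ) → ℂ := fun u ↦ MvPolynomial.eval (Pi.single i₀ 1 + finInsertCLM i₀ u) F
    with hfdef
  set u₀ := Φ c with hu₀def
  have hsymmc : (extChartAt 𝓘(ℂ, E) x).symm c = x := extChartAt_to_inv x
  have hu₀z : Pi.single i₀ 1 + finInsertCLM i₀ u₀ = z := by
    rw [hzdef, projLift_eq_single_add]
    simp only [hu₀def, hΦdef, Function.comp_apply, hsymmc]
  have hf : HasStrictFDerivAt f ((polyGrad F z).comp (finInsertCLM i₀)) u₀ := by
    have h1 := (hasStrictFDerivAt_eval_polyGrad F (Pi.single i₀ 1 + finInsertCLM i₀ u₀)).comp u₀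
      (((finInsertCLM (m := m) i₀).hasStrictFDerivAt).const_add (Pi.single i₀ (1 : ℂ)))
    rw [hu₀z] at h1
    exact h1
  have hk' : (polyGrad F z).comp (finInsertCLM i₀) (Pi.single k 1) ≠ 0 := by
    rw [ContinuousLinearMap.comp_apply, finInsertCLM_single, polyGrad_apply]
    simpa [Pi.single_apply, Finset.sum_ite_eq'] using hk
  obtain ⟨U, hU, hUinj⟩ := eq_of_finRemoveCLM_eq_of_hasStrictFDerivAt hf hk'
  obtain ⟨U', hU'U, hU'o, hu₀U'⟩ := mem_nhds_iff.mp hU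
  -- the domain of `Φ`
  set W := (extChartAt 𝓘(ℂ, E) x).target ∩ (extChartAt 𝓘(ℂ, E) x).symm ⁻¹' liftDomain ψ i₀ with hWdef
  have hWo : IsOpen W := isOpen_target_inter_preimage_liftDomain ψ hψc i₀ x
  have hcW : c ∈ W := ⟨mem_extChartAt_target x, by rw [mem_preimage, hsymmc]; exact hx⟩
  have hZW := differentiableOn_projLift_comp_symm ψ hψc hhol i₀ x
  have hΦW : DifferentiableOn ℂ Φ W := by
    intro y hy
    have hcomp : Φ = fun y ↦ fun l ↦ (projLift ψ i₀ ∘ (extChartAt 𝓘(ℂ, E) x).symm) y (i₀.succAbove l) := by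
      funext y; funext l
      simp only [hΦdef, Function.comp_apply, projLift, Fin.insertNth_apply_succAbove]
    rw [hcomp]
    refine differentiableWithinAt_pi.mpr fun l ↦ ?_
    exact (differentiableAt_apply (𝕜 := ℂ) (i₀.succAbove l)
      ((projLift ψ i₀ ∘ (extChartAt 𝓘(ℂ, E) x).symm) y)).comp_differentiableWithinAt y (hZW y hy)
  set W' := W ∩ Φ ⁻¹' U' with hW'def
  have hW'o : IsOpen W' := hΦW.continuousOn.isOpen_inter_preimage hWo hU'o
  have hcW' : c ∈ W' := ⟨hcW, hu₀U'⟩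
  -- `f ∘ Φ = 0` on `W`
  have hfΦ : ∀ y ∈ W, f (Φ y) = 0 := by
    intro y hy
    simp only [hfdef, hΦdef, Function.comp_apply]
    rw [← projLift_eq_single_add]
    exact eval_projLift_eq_zero ψ hF hrange hy.2
  -- `Φ` is injective on `W`
  have hΦinj : InjOn Φ W := by
    intro y hy y' hy' hyy'
    have h1 : ψ ((extChartAt 𝓘(ℂ, E) x).symm y) = ψ ((extChartAt 𝓘(ℂ, E) x).symm y') :=
      (stdChart i₀).injOn hy.2 hy'.2 hyy'
    have h2 := hψ.injective h1
    exact (extChartAt 𝓘(ℂ, E) x).symm.injOn hy.1 hy'.1 h2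
  -- `G = π_k ∘ Φ` is injective on `W'`, holomorphic, between spaces of dimension `m`
  set G := finRemoveCLM k ∘ Φ with hGdef
  have hGinj : InjOn G W' := by
    intro y hy y' hy' hG
    apply hΦinj hy.1 hy'.1
    exact hUinj (Φ y) (hU'U hy.2) (Φ y') (hU'U hy'.2) (hfΦ y hy.1) (hfΦ y' hy'.1) hG
  have hGd : DifferentiableOn ℂ G W' :=
    (finRemoveCLM k).differentiable.comp_differentiableOn (hΦW.mono inter_subset_left)
  have hdim' : Module.finrank ℂ E = Module.finrank ℂ (Fin m → ℂ) := by
    rw [hdim, Module.finrank_fin_fun]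
  have hGc := Literature.Analysis.Complex.SCV.injective_fderiv_of_injOn hdim' hGd hW'o hGinj hcW'
  have hGder : fderiv ℂ G c = (finRemoveCLM k).comp (fderiv ℂ Φ c) :=
    ((finRemoveCLM k).hasFDerivAt.comp c hΦd.hasFDerivAt).fderiv
  rw [hGder, ContinuousLinearMap.coe_comp] at hGc
  exact Function.Injective.of_comp hGc

/-- **Non-vanishing of the residue form.** Let `F` be homogeneous of degree `d ≥ m + 2` with
non-vanishing gradient at the non-zero zeros of `F`, `ψ : M → ℙ ℂ ℂ^{m+2}` a topological embedding
into the projective zero locus of `F` with holomorphic affine coordinates, `dim_ℂ E = m`. Then for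
`x ∈ M_{i₀}` the residue form with `P = X_{i₀}^{d-m-2}` does not vanish at `x`: by the local
formula it is `det(N, z, dZ̃_{i₀}(x) ·)` there (`P(z) = z_{i₀}^{d-m-2} = 1`), non-zero on a basis of
`E` (`coneResidue_apply_ne_zero_of_linearIndependent`, `linearIndependent_coneRows` with
`ℓ = dF(z)`, and the injectivity of `(v, c) ↦ dZ̃(x)v + c z` from the vanishing `i₀`-th coordinate
of `dZ̃_{i₀}(x)v` and `injective_liftDeriv`). In print: `Res(Ω/F)` is nowhere zero on `Y ∩ U_{i₀}`
(locally `± dx_K/(∂f/∂x_j)`; Voisin II, §6.1.3, Thm. 6.10 / Cor. 6.12 at `p = 1`).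
[cite: VoisinHodgeII2003, §6.1.3, Thm. 6.10 and Cor. 6.12 (p = 1)] -/
theorem residueForm_ne_zero (hF : F.IsHomogeneous d) (hψ : Topology.IsEmbedding ψ)
    (hrange : Set.range ψ ⊆ projZeroLocus {F})
    (hjac : ∀ z : Fin (m + 2) → ℂ, z ≠ 0 → MvPolynomial.eval z F = 0 →
      ∃ j, MvPolynomial.eval z (MvPolynomial.pderiv j F) ≠ 0)
    (hhol : HasHolomorphicCoords E ψ) (hdim : Module.finrank ℂ E = m) (hd : m + 2 ≤ d)
    {i₀ : Fin (m + 2)} {x : M} (hx : x ∈ liftDomain ψ i₀) :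
    residueForm (E := E) ψ F (MvPolynomial.X i₀ ^ (d - (m + 2))) x ≠ 0 := by
  have hψc : Continuous ψ := hψ.continuous
  set P : MvPolynomial (Fin (m + 2)) ℂ := MvPolynomial.X i₀ ^ (d - (m + 2)) with hPdef
  have hP : P.IsHomogeneous (d - (m + 2)) := by
    simpa using (MvPolynomial.isHomogeneous_X ℂ i₀).pow (d - (m + 2))
  set z := projLift ψ i₀ x with hzdef
  have hz0 : MvPolynomial.eval z F = 0 := eval_projLift_eq_zero ψ hF hrange hx
  have hzi : z i₀ = 1 := projLift_apply_self ψ i₀ x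
  obtain ⟨j, hj⟩ := hjac z (projLift_ne_zero ψ i₀ x) hz0
  have hloc := (residueForm_eventuallyEq ψ hF hψc hrange hjac hhol hP hd hx hj).self_of_nhds
  have hPz : MvPolynomial.eval z P = 1 := by simp [hPdef, hzi]
  set L := liftDeriv (E := E) ψ i₀ x with hLdef
  set N := normalVec F z j with hNdef
  set b := Module.finBasisOfFinrankEq ℂ E hdim with hbdef
  have hℓN : polyGrad F z N ≠ 0 := by rw [hNdef, polyGrad_normalVec hj]; exact one_ne_zero
  have hℓz : polyGrad F z z = 0 := by rw [polyGrad_apply_self hF, hz0, mul_zero]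
  have hℓL : ∀ w, polyGrad F z (L w) = 0 := fun w ↦ by
    have := polyGrad_comp_mfderiv_projLift ψ hF hψc hrange hhol hx
    exact DFunLike.congr_fun this w
  obtain ⟨hLJ, -⟩ := liftDeriv_eq_finInsertCLM_comp ψ hψc hhol hx
  have hLinj := injective_liftDeriv ψ hF hψ hrange hjac hhol hdim hx
  have hinj : ∀ (w : E) (c : ℂ), w ∈ Submodule.span ℂ (Set.range b) → L w + c • z = 0 →
      w = 0 ∧ c = 0 := by
    intro w c _ h
    have hi₀ : (L w) i₀ = 0 := by
      rw [hLdef, hLJ]; simp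
    have hc : c = 0 := by
      have := congrFun h i₀
      rw [Pi.add_apply, Pi.smul_apply, hi₀, hzi, smul_eq_mul, mul_one, zero_add] at this
      exact this
    refine ⟨hLinj ?_, hc⟩
    rw [hc, zero_smul, add_zero] at h
    rw [h, map_zero]
  have hli := linearIndependent_coneRows N z L b (polyGrad F z : (Fin (m + 2) → ℂ) →ₗ[ℂ] ℂ)
    hℓN hℓz hℓL b.linearIndependent hinj
  have hne := coneResidue_apply_ne_zero_of_linearIndependent N z L b hli
  intro h0
  apply hne
  have h1 : (show E [⋀^Fin m]→L[ℝ] ℂ from (residueFormula ψ F P i₀ j x).restrictScalars ℝ) = 0 := by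
    rw [← hloc]; exact h0
  have h2 := congrArg (fun (A : E [⋀^Fin m]→L[ℝ] ℂ) ↦ A (fun l ↦ b l)) h1
  simp only [ContinuousAlternatingMap.coe_zero, Pi.zero_apply] at h2
  change (residueFormula ψ F P i₀ j x) (fun l ↦ b l) = 0 at h2
  rw [residueFormula, ContinuousAlternatingMap.smul_apply, ← hzdef, hPz, one_smul] at h2
  exact h2

end Main

end Literature.AlgebraicGeometry.HodgeTheory

end
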